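import Summits.ABC.IUTFork.LanaEtaAlgorithm
import Summits.ABC.IUTFork.LanaKummerTowerInjective
import HarnessLib

/-!
# L-LANA objects VII bis: the `η`-algorithm signature with REAL local Kummer maps `κ_t` (LANA §6.2 (g); N14 Step 6 RESOLVED, `hκ` DISCHARGED at `ℚ_p`)

Record-only file (D-0012) of the abc-iut cell (seat abc-iut-c312-4, L-LANA level, plan/LLANA-SPEC N14 Step 6);
TAKES NO SIDE on [IUTchIII] Cor. 3.12. `LanaEtaAlgorithm.lean` (gen 0) types Fig. 3 / Fig. 6 of the LANA report as
a SIGNATURE `EtaSteps` all of whose groups and arrows are abstract, and PROVES the bookkeeping of §6.2 (g)/§9.1 (f)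
("`φ_v` injective", "Containment ⟺ Factors, uniquely") under the hypothesis `hκ`: injectivity of the local Kummer
maps "`κ_t : O^▷_{v,t} → ∞H¹(D_t, Λ_{v,t})`" (§6.2 (g) p. 35). Gen 2 has CONSTRUCTED these maps at a place
(`AlgCl.kummerTowerInt K_{v,t} : O^▷_{K̄_{v,t}} → lim_{→ H} H¹(H, Λ(K̄_{v,t}^×))`, `LanaKummerTower.lean`) and PROVED
their injectivity for torally Kummer-faithful `K_{v,t}`, unconditionally at `ℚ_p` (`LanaKummerTowerInjective.lean`).
THIS FILE plugs them into the signature: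

* `EtaThetaSide` — the data of Fig. 3 OTHER THAN Step 6's local Kummer side: Steps 2–5 and 7 as in `EtaSteps`
  (étale theta classes, `M^{Θ,Frob}`, Kummer map of the theta monoid, `Θ-Λ-rgd`, labels `t`, restrictions to
  `D_t`), the local FIELDS `K_{v,t}` at the labels (complete ultrametric, characteristic `0`), the cyclotomic
  synchronizations `(ι_t)_* : ∞H¹(D_t, C_v) ⥲ ∞H¹(D_t, Λ_{v,t})` now landing in the REAL `∞H¹`, and the theta
  values `q_v^{t²} ∈ O^▷_{v,t}` now in the REAL `O^▷`;
* `EtaThetaSide.toEtaSteps` — the `EtaSteps` with `O t := O^▷_{K̄_{v,t}}`, `H1DΛ t := ∞H¹(G_{v,t}, Λ)`,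
  `kappa t := κ` (REAL); `toEtaSteps_kappa` records the identification by `rfl`;
* `toEtaSteps_phiProd_injective`, `toEtaSteps_containment_iff_factors`, `toEtaSteps_factorisation_unique` — the
  §6.2 (g)/§9.1 (f) bookkeeping with `hκ` DISCHARGED from torus Kummer-faithfulness of the `K_{v,t}` — for a
  side built with `K := fun _ => ℚ_[p]` the hypothesis is L4's `fun _ => AbsTopIII.isTorallyKummerFaithful_padic p`, i.e.
  nothing is left to assume.

[cite: LANA2026Report, §6.2 (g) pp. 35–36, §9.1 (f) p. 45] NOT here: the étale theta side (Steps 2–5: [EtTh],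
abc-iut-L2; the Gaussian monoid: [IUTchII], abc-iut-L6), `D_t ⊆ Π_v` (here `D_t` acts through `G_{v,t}`), the
Containment itself (Thm. 3.11 (ii) content), any judgement.
-/

noncomputable section

namespace Summit.ABC
namespace IUTFork

open Literature.AnabelianGeometry.AbsoluteAnabelian.AbsTopIII (IsTorallyKummerFaithful)

/-- **Fig. 3 minus Step 6's Kummer side, over REAL local fields at the labels.** See the module docstring;
each remaining abstract field quotes the same sentence as in `EtaSteps`. [cite: LANA2026Report, §6.2 pp. 33–36] -/
structure EtaThetaSide : Type 1 where
  /-- `∞H¹(Π_{v,Ÿ}, (l·Δ_Θ)(Π_v))` (interior coefficients), Steps 2–3 -/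
  H1Y : Type
  [instH1Y : CommGroup H1Y]
  /-- `θ(Π_v)` (6-1) -/
  thetaClasses : Set H1Y
  /-- `∞θ(Π_v)` -/
  thetaInf : Submonoid H1Y
  /-- `O^×_v(Π_v)` -/
  unitsEt : Submonoid H1Y
  /-- `θ(Π_v) ⊆ ∞θ(Π_v)` -/
  thetaClasses_subset : thetaClasses ⊆ thetaInf
  /-- `M^{Θ,Frob}_{v,∞}` (Step 4) -/
  MFrob : Type
  [instMFrob : CommMonoid MFrob]
  /-- `∞H¹(Π_{v,Ÿ}, Λ^{ext}_{Θ,v})` -/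
  H1Yext : Type
  [instH1Yext : CommGroup H1Yext]
  /-- the Kummer map of the theta monoid -/
  kum : MFrob →* H1Yext
  /-- the isomorphism induced by `Θ-Λ-rgd` (6-2) -/
  rgd : H1Yext ≃* H1Y
  /-- the labels `t` (Step 5) -/
  T : Type
  /-- the local field `K_{v,t}` at the label `t` -/
  K : T → Type
  [instField : ∀ t, NontriviallyNormedField (K t)]
  [instComplete : ∀ t, CompleteSpace (K t)]
  [instUltra : ∀ t, IsUltrametricDist (K t)]
  [instCharZero : ∀ t, CharZero (K t)]
  /-- `∞H¹(D_t, (l·Δ_Θ)(Π_v))` -/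
  H1D : T → Type
  [instH1D : ∀ t, CommGroup (H1D t)]
  /-- restriction to `D_t` (6-3) -/
  res : ∀ t, H1Y →* H1D t
  /-- cyclotomic synchronization `(ι_t)_*`, landing in the REAL `∞H¹(G_{v,t}, Λ(K̄_{v,t}^×))` -/
  sync : ∀ t, H1D t ≃* Multiplicative (AlgCl.H1Tower (K t))
  /-- the theta values `q_v^{t²}` in the REAL `O^▷_{K̄_{v,t}}` -/
  qPow : ∀ t, intMonoid (AlgCl.val (K t))

attribute [instance] EtaThetaSide.instH1Y EtaThetaSide.instMFrob EtaThetaSide.instH1Yext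
  EtaThetaSide.instField EtaThetaSide.instComplete EtaThetaSide.instUltra EtaThetaSide.instCharZero
  EtaThetaSide.instH1D

namespace EtaThetaSide

variable (X : EtaThetaSide)

/-- **The `η`-algorithm signature with REAL Step 6**: `O^▷_{v,t} := O^▷_{K̄_{v,t}}`,
`∞H¹(D_t, Λ_{v,t}) := lim_{→ H} H¹(H, Λ(K̄_{v,t}^×))`, `κ_t :=` the constructed local Kummer map
`AlgCl.kummerTowerInt` (§6.2 (g) "`κ_t : O^▷_{v,t} → ∞H¹(D_t, Λ_{v,t})` is the local Kummer map").
[cite: LANA2026Report, §6.2 (g) p. 35] -/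
def toEtaSteps : EtaSteps where
  H1Y := X.H1Y
  thetaClasses := X.thetaClasses
  thetaInf := X.thetaInf
  unitsEt := X.unitsEt
  thetaClasses_subset := X.thetaClasses_subset
  MFrob := X.MFrob
  H1Yext := X.H1Yext
  kum := X.kum
  rgd := X.rgd
  T := X.T
  H1D := X.H1D
  res := X.res
  O t := intMonoid (AlgCl.val (X.K t))
  H1DΛ t := Multiplicative (AlgCl.H1Tower (X.K t))
  kappa t := AlgCl.kummerTowerInt (X.K t)
  sync := X.sync
  qPow := X.qPow

/-- Step 6 is REAL: the signature's `κ_t` IS the constructed local Kummer map. [cite: LANA2026Report, §6.2 (g) p. 35] -/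
theorem toEtaSteps_kappa (t : X.T) : X.toEtaSteps.kappa t = AlgCl.kummerTowerInt (X.K t) := rfl

/-- `φ_{v,t} = (ι_t)_*⁻¹ ∘ κ_t` with the real `κ_t`. [cite: LANA2026Report, §6.2 (g) p. 35] -/
theorem toEtaSteps_phi_apply (t : X.T) (a : intMonoid (AlgCl.val (X.K t))) :
    X.toEtaSteps.phi t a = (X.sync t).symm (AlgCl.kummerTowerInt (X.K t) a) := rfl

/-- **`hκ` DISCHARGED**: the real local Kummer maps are injective as soon as every `K_{v,t}` is torally
Kummer-faithful ([AbsTopIII] Def. 1.5; every nonarchimedean local field is, L4), so **`φ_v := ∏_t φ_{v,t}` is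
injective** (§6.2 (g)). [cite: LANA2026Report, §6.2 (g) pp. 35–36] -/
theorem toEtaSteps_phiProd_injective (hK : ∀ t, IsTorallyKummerFaithful (X.K t)) :
    Function.Injective X.toEtaSteps.phiProd :=
  X.toEtaSteps.phiProd_injective fun t => AlgCl.kummerTowerInt_injective_of (X.K t) (hK t)

/-- **Containment ⟺ Factors** (p. 36 / §9.1 (f) p. 45) for the signature with real `κ_t`, torally
Kummer-faithful `K_{v,t}`. [cite: LANA2026Report, §6.2 (g) p. 36, §9.1 (f) p. 45] -/
theorem toEtaSteps_containment_iff_factors (hK : ∀ t, IsTorallyKummerFaithful (X.K t)) :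
    X.toEtaSteps.Containment ↔ X.toEtaSteps.Factors :=
  X.toEtaSteps.containment_iff_factors fun t => AlgCl.kummerTowerInt_injective_of (X.K t) (hK t)

/-- … and the factorisation `λ` of `ψ_v` through `φ_v` is UNIQUE. [cite: LANA2026Report, §9.1 (f) p. 45] -/
theorem toEtaSteps_factorisation_unique (hK : ∀ t, IsTorallyKummerFaithful (X.K t))
    (lam lam' : X.toEtaSteps.MFrob →* ∀ t, X.toEtaSteps.O t)
    (h : X.toEtaSteps.phiProd.comp lam = X.toEtaSteps.psi) (h' : X.toEtaSteps.phiProd.comp lam' = X.toEtaSteps.psi) :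
    lam = lam' :=
  X.toEtaSteps.factorisation_unique (fun t => AlgCl.kummerTowerInt_injective_of (X.K t) (hK t)) lam lam' h h'

end EtaThetaSide

end IUTFork

end Summit.ABC

end
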